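import Summits.QuantumAdvantage.QuantumAdvantage.Theses.LinnikCubicClassGroups
import Literature.Computability.Complexity.QuadraticCongruencesFactNP
import Literature.Computability.Complexity.CodeFPModArith
import Literature.Computability.Complexity.CodeFPStringKit
import Literature.Computability.Complexity.CodeFPListKit
import Literature.Computability.Complexity.CodeFPLists
import Literature.Computability.Complexity.CodeFPStrings
import Literature.Computability.Complexity.StackWords
import Literature.Computability.Cryptography.VanDamSeroussiOracleFP
import Literature.Barriers.QuantumAdvantage.PBlockedSimDescription
import Literature.Algebra.EuclideanLattices.SimultaneousApproximationLLLProofs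

/-!
# Crux `LinnikCubicClassGroups.PureCubicClassGroupFBQP` (stmt-QuantumAdvantage-11544) — stub `stub_assemblyCore`

Line `arakelov-giant-step-cycle`, stub S6a (skeleton v6): the two `FP` programs around the quantum core, in the
tree's typed polynomial-time algebra `CodeFP` (`Complexity/CodeFP*.lean`). A query to the core language is the
canonical code `⟨⟨x, ⟨qs, ps⟩⟩, i⟩` (`qs` a prime factorisation of `m = decodeNat x`, `ps` the handed primes, `i` a
bit index).

* (h) the PRE-PROCESSOR `⟨⟨x, ⟨qs, ps⟩⟩, i⟩ ↦ ⟨x, ⟨⟨f, a, b⟩, ps⟩⟩` with `f = ∏ q^{⌊e_q/3⌋}`, `a = ∏_{e_q ≡ 1 (3)} q`,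
  `b = ∏_{e_q ≡ 2 (3)} q` over the distinct `q ∈ qs` (so `∏ qs = f³ab²`, `ab` squarefree when the `q` are prime,
  `assemblyCore_fab_spec`): decoding of the fields (`Knapsack.decNatList`), `CodeFP.dedup`, `rawCountNat`,
  `natDiv`/`natMod`, `natPow`, a product fold, re-pairing;
* (g) the POST-PROCESSOR `⟨u, y⟩ ↦ [bit]`, `bit` = "`u` is a canonical query (it re-encodes to itself), on the
  promise (every `q ∈ qs` prime — `PRIMES ∈ P`, Agrawal–Kayal–Saxena, the tree's `QuadCongNP.primeFn` —,
  `∏ qs = m`, `m` not a cube — iff `a = b = 1`, `assemblyCore_cube_iff` —, every `p ∈ ps` prime and `∤ 3m`), and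
  bit `i` of the first component of `y` is set".

Definition-free: intermediate programs are `CodeFP` facts about explicit maps.
-/

set_option linter.dupNamespace false

namespace Summit.QuantumAdvantage.QuantumAdvantage.Theorems.LinnikCubicClassGroups

open Computability (encodeNat decodeNat encodingNatBool)
open Literature.Computability.Complexity (boolPair boolUnpair boolUnpair_boolPair encodingListNatBool FP CodeFP
  comp_mem_FP)
open Literature.Computability.Complexity.CodeFP
open Literature.Computability.Complexity.Brick (fstF sndF fstF_mem_FP sndF_mem_FP canonF canonF_mem_FP
  canonF_eq_encodeNat_decodeNat)
open Literature.Computability.Complexity.Knapsack (decNatList canonLFn canonLFn_eq canonLFn_mem_FP decNatList_encode)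

/-! ## Arithmetic of the triple `⟨f, a, b⟩` -/

/-- The multiplicities of a prime factorisation of a cube are divisible by `3`. -/
theorem assemblyCore_count_mod_three {qs : List ℕ} (hqs : ∀ q ∈ qs, q.Prime) {r : ℕ} (hr : r ^ 3 = qs.prod)
    (q : ℕ) : qs.count q % 3 = 0 := by
  have hperm := Nat.primeFactorsList_unique hr.symm hqs
  rw [hperm.count_eq, Nat.primeFactorsList_count_eq, Nat.factorization_pow]
  simp

/-- **The cube test**: for a prime factorisation `qs`, `∏ qs` is a cube iff `a = b = 1`. -/
theorem assemblyCore_cube_iff {qs : List ℕ} (hqs : ∀ q ∈ qs, q.Prime) :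
    (∃ r : ℕ, r ^ 3 = qs.prod) ↔ (∏ q ∈ qs.toFinset with qs.count q % 3 = 1, q) = 1 ∧
      (∏ q ∈ qs.toFinset with qs.count q % 3 = 2, q) = 1 := by
  have hone : ∀ k, ∀ p ∈ qs.toFinset.filter (fun q => qs.count q % 3 = k), 1 ≤ p := fun k p hp =>
    (hqs p (List.mem_toFinset.1 (Finset.mem_filter.1 hp).1)).one_lt.le
  constructor
  · rintro ⟨r, hr⟩
    have h0 := assemblyCore_count_mod_three hqs hr
    constructor <;>
    · refine Finset.prod_eq_one fun q hq => ?_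
      have h0q := h0 q
      have := (Finset.mem_filter.1 hq).2
      omega
  · rintro ⟨ha, hb⟩
    refine ⟨∏ q ∈ qs.toFinset, q ^ (qs.count q / 3), ?_⟩
    rw [Finset.prod_list_count, ← Finset.prod_pow]
    refine Finset.prod_congr rfl fun q hq => ?_
    rw [← pow_mul]
    congr 1
    have hq1 : q ≠ 1 := (hqs q (List.mem_toFinset.1 hq)).one_lt.ne'
    have h3 : qs.count q % 3 < 3 := Nat.mod_lt _ (by norm_num)
    have h1 : qs.count q % 3 ≠ 1 := fun h =>
      hq1 ((Finset.prod_eq_one_iff_of_one_le' (hone 1)).1 ha q (Finset.mem_filter.2 ⟨hq, h⟩))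
    have h2 : qs.count q % 3 ≠ 2 := fun h =>
      hq1 ((Finset.prod_eq_one_iff_of_one_le' (hone 2)).1 hb q (Finset.mem_filter.2 ⟨hq, h⟩))
    omega

/-- A product of distinct primes is squarefree. -/
theorem assemblyCore_squarefree_prod (s : Finset ℕ) (hs : ∀ q ∈ s, q.Prime) : Squarefree (∏ q ∈ s, q) := by
  have hl : s.toList.prod = ∏ q ∈ s, q := by simp
  have hpos : (∏ q ∈ s, q) ≠ 0 := Finset.prod_ne_zero_iff.2 fun q hq => (hs q hq).ne_zero
  rw [Nat.squarefree_iff_nodup_primeFactorsList hpos]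
  exact (Nat.primeFactorsList_unique hl (by simpa using hs)).nodup_iff.1 (Finset.nodup_toList s)

/-- **The triple is S5b's promise**: `∏ qs = f³·a·b²` and `ab` is squarefree. -/
theorem assemblyCore_fab_spec {qs : List ℕ} (hqs : ∀ q ∈ qs, q.Prime) :
    qs.prod = (∏ q ∈ qs.toFinset, q ^ (qs.count q / 3)) ^ 3 *
      ((∏ q ∈ qs.toFinset with qs.count q % 3 = 1, q) * (∏ q ∈ qs.toFinset with qs.count q % 3 = 2, q) ^ 2) ∧
    Squarefree ((∏ q ∈ qs.toFinset with qs.count q % 3 = 1, q) * ∏ q ∈ qs.toFinset with qs.count q % 3 = 2, q) := by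
  have hT : ∀ q ∈ qs.toFinset, q.Prime := fun q hq => hqs q (List.mem_toFinset.1 hq)
  constructor
  · rw [Finset.prod_list_count, ← Finset.prod_pow, ← Finset.prod_pow, Finset.prod_filter, Finset.prod_filter,
      ← Finset.prod_mul_distrib, ← Finset.prod_mul_distrib]
    refine Finset.prod_congr rfl fun q _ => ?_
    have h3 : qs.count q % 3 < 3 := Nat.mod_lt _ (by norm_num)
    rw [show q ^ qs.count q = q ^ (qs.count q / 3 * 3 + qs.count q % 3) by rw [Nat.div_add_mod'], pow_add, pow_mul]
    interval_cases h : qs.count q % 3 <;> simp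
  · rw [← Finset.prod_union (Finset.disjoint_filter.2 fun q _ h1 h2 => by omega)]
    exact assemblyCore_squarefree_prod _ fun q hq => hT q (by
      rcases Finset.mem_union.1 hq with h | h <;> exact (Finset.mem_filter.1 h).1)

/-! ## The triple on codes -/

/-- The multiplicity of an item, from the context `qs`. -/
theorem assemblyCore_codeFP_count : CodeFP (pairE (rawE natE) natE) natE (fun p => p.1.count p.2) :=
  (rawCountNat.comp ((snd _ _).pair (fst _ _))).congr fun _ => rfl

/-- `q ^ min (e_q / 3) |qs|` on codes. -/
theorem assemblyCore_codeFP_term₀ :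
    CodeFP (pairE (rawE natE) natE) natE (fun p => p.2 ^ min (p.1.count p.2 / 3) p.1.length) :=
  (natPow.comp ((snd _ _).pair (unOfNatMin.comp (((ulength natE).comp (fst _ _)).pair
    (natDiv.comp (assemblyCore_codeFP_count.pair (const _ 3))))))).congr fun _ => rfl

/-- `[e_q ≡ k (3)] ? q : 1` on codes. -/
theorem assemblyCore_codeFP_term (k : ℕ) :
    CodeFP (pairE (rawE natE) natE) natE (fun p => if p.1.count p.2 % 3 = k then p.2 else 1) :=
  ((natEq.comp ((natMod.comp (assemblyCore_codeFP_count.pair (const _ 3))).pair (const _ k))).ite (snd _ _)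
    (const _ 1)).congr fun p => by dsimp only; by_cases h : p.1.count p.2 % 3 = k <;> simp [h]

/-- **The triple `⟨f, a, b⟩` on codes** (computed over `qs.dedup`, then identified with the `Finset` products). -/
theorem assemblyCore_codeFP_fab : CodeFP (listE natE) (pairE natE (pairE natE natE)) (fun qs =>
    (∏ q ∈ qs.toFinset, q ^ (qs.count q / 3),
      ∏ q ∈ qs.toFinset with qs.count q % 3 = 1, q, ∏ q ∈ qs.toFinset with qs.count q % 3 = 2, q)) := by
  have cRaw : CodeFP (listE natE) (rawE natE) id := rawOfList natE
  have cD : CodeFP (listE natE) (pairE (rawE natE) (rawE natE)) (fun qs => (qs, qs.dedup)) :=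
    (cRaw.pair ((CodeFP.dedup natE natE_injective).comp cRaw)).congr fun _ => rfl
  have cP : ∀ {g : List ℕ × ℕ → ℕ}, CodeFP (pairE (rawE natE) natE) natE g →
      CodeFP (listE natE) natE (fun qs => (qs.dedup.map fun q => g (qs, q)).prod) := fun hg =>
    (Literature.Algebra.EuclideanLattices.SimApproxLLL.prodFP.comp ((CodeFP.map hg).comp cD)).congr fun _ => rfl
  refine (((cP assemblyCore_codeFP_term₀).pair ((cP (assemblyCore_codeFP_term 1)).pair
    (cP (assemblyCore_codeFP_term 2)))).congr fun qs => rfl).congr fun qs => ?_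
  have hT : qs.dedup.toFinset = qs.toFinset := Finset.ext fun q => by simp
  have hmap : ∀ f : ℕ → ℕ, (qs.dedup.map f).prod = ∏ q ∈ qs.toFinset, f q := fun f => by
    rw [← List.prod_toFinset f (List.nodup_dedup qs), hT]
  simp only [hmap, Finset.prod_filter]
  congr 1
  refine Finset.prod_congr rfl fun q _ => ?_
  rw [Nat.min_eq_left ((Nat.div_le_self _ _).trans (List.count_le_length))]

/-! ## Decoding a query -/

/-- The fields `x`, `qs`, `ps`, `i` of a canonical query. -/
theorem assemblyCore_fields (x : List Bool) (qs ps : List ℕ) (i : ℕ) :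
    (boolUnpair (boolUnpair (boolPair (boolPair x (boolPair (encodingListNatBool.encode qs)
      (encodingListNatBool.encode ps))) (encodeNat i))).1).1 = x ∧
    decNatList (boolUnpair (boolUnpair (boolUnpair (boolPair (boolPair x (boolPair (encodingListNatBool.encode qs)
      (encodingListNatBool.encode ps))) (encodeNat i))).1).2).1 = qs ∧
    decNatList (boolUnpair (boolUnpair (boolUnpair (boolPair (boolPair x (boolPair (encodingListNatBool.encode qs)
      (encodingListNatBool.encode ps))) (encodeNat i))).1).2).2 = ps ∧
    decodeNat (boolUnpair (boolPair (boolPair x (boolPair (encodingListNatBool.encode qs)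
      (encodingListNatBool.encode ps))) (encodeNat i))).2 = i := by
  simp [boolUnpair_boolPair, decNatList_encode]

/-- **The decoded fields on codes**: `u ↦ ((x, (qs, ps)), i)`. -/
theorem assemblyCore_codeFP_flds : CodeFP strE (pairE (pairE strE (pairE (listE natE) (listE natE))) natE) (fun u =>
    (((boolUnpair (boolUnpair u).1).1, (decNatList (boolUnpair (boolUnpair (boolUnpair u).1).2).1,
      decNatList (boolUnpair (boolUnpair (boolUnpair u).1).2).2)), decodeNat (boolUnpair u).2)) := by
  have cX : CodeFP strE strE (fun u => (boolUnpair (boolUnpair u).1).1) :=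
    ⟨fstF ∘ fstF, comp_mem_FP fstF_mem_FP fstF_mem_FP, fun _ => rfl⟩
  have cQ : CodeFP strE (listE natE) (fun u => decNatList (boolUnpair (boolUnpair (boolUnpair u).1).2).1) :=
    ⟨canonLFn ∘ fstF ∘ sndF ∘ fstF, comp_mem_FP canonLFn_mem_FP (comp_mem_FP fstF_mem_FP (comp_mem_FP sndF_mem_FP
      fstF_mem_FP)), fun u => by simp only [Function.comp_apply, canonLFn_eq, Literature.Barriers.QuantumAdvantage.PSim.encodingListNatBool_encode]; rfl⟩
  have cP : CodeFP strE (listE natE) (fun u => decNatList (boolUnpair (boolUnpair (boolUnpair u).1).2).2) :=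
    ⟨canonLFn ∘ sndF ∘ sndF ∘ fstF, comp_mem_FP canonLFn_mem_FP (comp_mem_FP sndF_mem_FP (comp_mem_FP sndF_mem_FP
      fstF_mem_FP)), fun u => by simp only [Function.comp_apply, canonLFn_eq, Literature.Barriers.QuantumAdvantage.PSim.encodingListNatBool_encode]; rfl⟩
  have cI : CodeFP strE natE (fun u => decodeNat (boolUnpair u).2) :=
    ⟨canonF ∘ sndF, comp_mem_FP canonF_mem_FP sndF_mem_FP, fun u => by
      rw [Function.comp_apply, canonF_eq_encodeNat_decodeNat]; rfl⟩
  exact (cX.pair (cQ.pair cP)).pair cI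

/-- **Canonicity of a query is decidable on codes**: a string is a canonical query iff it re-encodes to itself. -/
theorem assemblyCore_codeFP_canon {P : List Bool → Bool}
    (hP : ∀ u, P u = true ↔ ∃ (x : List Bool) (qs ps : List ℕ) (i : ℕ),
      u = boolPair (boolPair x (boolPair (encodingListNatBool.encode qs) (encodingListNatBool.encode ps))) (encodeNat i)) :
    CodeFP strE bitE P := by
  -- the canonical re-encoding of the decoded fields
  have cR : CodeFP strE strE (fun u => boolPair (boolPair (boolUnpair (boolUnpair u).1).1
      (boolPair (encodingListNatBool.encode (decNatList (boolUnpair (boolUnpair (boolUnpair u).1).2).1))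
        (encodingListNatBool.encode (decNatList (boolUnpair (boolUnpair (boolUnpair u).1).2).2))))
      (encodeNat (decodeNat (boolUnpair u).2))) :=
    assemblyCore_codeFP_flds.recodeOut (eγ := strE) fun u => by simp [Literature.Barriers.QuantumAdvantage.PSim.encodingListNatBool_encode, pairE]
  refine ((CodeFP.eq (eα := strE) fun _ _ h => h).comp (cR.pair (CodeFP.id strE))).congr fun u => ?_
  dsimp only [id]
  rw [← Bool.coe_iff_coe, hP u, decide_eq_true_iff]
  constructor
  · exact fun h => ⟨_, _, _, _, h.symm⟩
  · rintro ⟨x, qs, ps, i, rfl⟩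
    obtain ⟨h1, h2, h3, h4⟩ := assemblyCore_fields x qs ps i
    rw [h1, h2, h3, h4]

/-! ## The pre-processor -/

/-- **Sub-goal (h)**: a polynomial-time pre-processor writing S5b's input `⟨x, ⟨⟨f, a, b⟩, ps⟩⟩` on every canonical
query, `⟨f, a, b⟩` a cube-free decomposition of `∏ qs`. -/
theorem assemblyCore_pre : ∃ h : List Bool → List Bool, h ∈ FP ∧ ∀ (x : List Bool) (qs ps : List ℕ) (i : ℕ),
    ∃ f a b : ℕ, h (boolPair (boolPair x (boolPair (encodingListNatBool.encode qs) (encodingListNatBool.encode ps)))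
        (encodeNat i)) =
      boolPair x (boolPair (boolPair (encodeNat f) (boolPair (encodeNat a) (encodeNat b)))
        (encodingListNatBool.encode ps)) ∧
    ((∀ q ∈ qs, q.Prime) → qs.prod = f ^ 3 * (a * b ^ 2) ∧ Squarefree (a * b)) := by
  have h : CodeFP strE strE (fun u => boolPair (boolUnpair (boolUnpair u).1).1 (boolPair (boolPair
      (encodeNat (∏ q ∈ (decNatList (boolUnpair (boolUnpair (boolUnpair u).1).2).1).toFinset,
        q ^ ((decNatList (boolUnpair (boolUnpair (boolUnpair u).1).2).1).count q / 3)))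
      (boolPair (encodeNat (∏ q ∈ (decNatList (boolUnpair (boolUnpair (boolUnpair u).1).2).1).toFinset with
        (decNatList (boolUnpair (boolUnpair (boolUnpair u).1).2).1).count q % 3 = 1, q))
      (encodeNat (∏ q ∈ (decNatList (boolUnpair (boolUnpair (boolUnpair u).1).2).1).toFinset with
        (decNatList (boolUnpair (boolUnpair (boolUnpair u).1).2).1).count q % 3 = 2, q))))
      (encodingListNatBool.encode (decNatList (boolUnpair (boolUnpair (boolUnpair u).1).2).2)))) :=
    (assemblyCore_codeFP_flds.fst'.fst'.pair ((assemblyCore_codeFP_fab.comp assemblyCore_codeFP_flds.fst'.snd'.fst').pair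
      assemblyCore_codeFP_flds.fst'.snd'.snd')).recodeOut fun u => by simp [Literature.Barriers.QuantumAdvantage.PSim.encodingListNatBool_encode, pairE]
  obtain ⟨f, hf, hfs⟩ := h
  refine ⟨f, hf, fun x qs ps i => ⟨_, _, _, ?_, assemblyCore_fab_spec⟩⟩
  obtain ⟨h1, h2, h3, -⟩ := assemblyCore_fields x qs ps i
  have := hfs (boolPair (boolPair x (boolPair (encodingListNatBool.encode qs) (encodingListNatBool.encode ps)))
    (encodeNat i))
  dsimp only [strE, id] at this
  rw [h1, h2, h3] at this
  exact this

/-! ## The post-processor -/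

/-- **The promise is decidable on codes** (context `(x, (qs, ps))`): every `q ∈ qs` prime, `∏ qs = m`, `m` not a
cube (`a = b = 1` test, `assemblyCore_cube_iff`), every `p ∈ ps` prime and `∤ 3m`. -/
theorem assemblyCore_codeFP_promise {P : List Bool × (List ℕ × List ℕ) → Bool}
    (hP : ∀ t, P t = true ↔ (∀ q ∈ t.2.1, q.Prime) ∧ t.2.1.prod = decodeNat t.1 ∧
      (¬ ∃ r : ℕ, r ^ 3 = decodeNat t.1) ∧ (∀ p ∈ t.2.2, p.Prime ∧ ¬ p ∣ 3 * decodeNat t.1)) :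
    CodeFP (pairE strE (pairE (listE natE) (listE natE))) bitE P := by
  have cDec : CodeFP strE natE decodeNat := ⟨canonF, canonF_mem_FP, fun w => canonF_eq_encodeNat_decodeNat w⟩
  have cM : CodeFP (pairE strE (pairE (listE natE) (listE natE))) natE (fun t => decodeNat t.1) := cDec.comp (fst _ _)
  have cQs : CodeFP (pairE strE (pairE (listE natE) (listE natE))) (rawE natE) (fun t => t.2.1) :=
    (rawOfList natE).comp (snd _ _).fst'
  have cPs : CodeFP (pairE strE (pairE (listE natE) (listE natE))) (rawE natE) (fun t => t.2.2) :=
    (rawOfList natE).comp (snd _ _).snd'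
  have c1 : CodeFP (pairE strE (pairE (listE natE) (listE natE))) bitE (fun t => t.2.1.all fun q => decide q.Prime) :=
    ((all (Literature.Computability.Cryptography.VDSOracle.codeFP_prime.comp (snd (pairE strE (pairE (listE natE) (listE natE))) natE))).comp
      ((CodeFP.id _).pair cQs)).congr fun _ => rfl
  have c2 : CodeFP (pairE strE (pairE (listE natE) (listE natE))) bitE
      (fun t => decide (t.2.1.prod = decodeNat t.1)) :=
    natEq.comp ((Literature.Algebra.EuclideanLattices.SimApproxLLL.prodFP.comp cQs).pair cM)
  have cFab := assemblyCore_codeFP_fab.comp (snd strE (pairE (listE natE) (listE natE))).fst'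
  have c3 : CodeFP (pairE strE (pairE (listE natE) (listE natE))) bitE (fun t =>
      !(decide ((∏ q ∈ t.2.1.toFinset with t.2.1.count q % 3 = 1, q) = 1) &&
        decide ((∏ q ∈ t.2.1.toFinset with t.2.1.count q % 3 = 2, q) = 1))) :=
    ((natEq.comp (cFab.snd'.fst'.pair (const _ 1))).and (natEq.comp (cFab.snd'.snd'.pair (const _ 1)))).not
  have cItem : CodeFP (pairE (pairE strE (pairE (listE natE) (listE natE))) natE) bitE
      (fun s => decide s.2.Prime && !decide (3 * decodeNat s.1.1 % s.2 = 0)) :=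
    (Literature.Computability.Cryptography.VDSOracle.codeFP_prime.comp (snd _ _)).and (natEq.comp ((natMod.comp ((natMul.comp ((const _ 3).pair
      (cM.comp (fst _ _)))).pair (snd _ _))).pair (const _ 0))).not
  have c4 : CodeFP (pairE strE (pairE (listE natE) (listE natE))) bitE
      (fun t => t.2.2.all fun p => decide p.Prime && !decide (3 * decodeNat t.1 % p = 0)) :=
    ((all cItem).comp ((CodeFP.id _).pair cPs)).congr fun _ => rfl
  refine (((c1.and c2).and c3).and c4).congr fun t => ?_
  rw [← Bool.coe_iff_coe, hP t]
  simp only [Bool.and_eq_true, List.all_eq_true, decide_eq_true_eq, Bool.not_eq_true', Bool.and_eq_false_iff,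
    decide_eq_false_iff_not]
  constructor
  · rintro ⟨⟨⟨hprime, hprod⟩, hnc⟩, hps⟩
    refine ⟨hprime, hprod, fun hc => ?_, fun p hp => ⟨(hps p hp).1, fun hd => (hps p hp).2 (Nat.mod_eq_zero_of_dvd hd)⟩⟩
    rw [← hprod, assemblyCore_cube_iff hprime] at hc
    exact hnc.elim (fun h => h hc.1) (fun h => h hc.2)
  · rintro ⟨hprime, hprod, hnc, hps⟩
    refine ⟨⟨⟨hprime, hprod⟩, ?_⟩, fun p hp => ⟨(hps p hp).1, fun hd => (hps p hp).2 (Nat.dvd_of_mod_eq_zero hd)⟩⟩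
    by_contra hcon
    push Not at hcon
    exact hnc (by rw [← hprod, assemblyCore_cube_iff hprime]; exact hcon)

/-- **Sub-goal (g)**: a polynomial-time post-processor emitting the bit "canonical ∧ promise ∧ bit `i` of the first
component of `y`" on `⟨u, y⟩`. -/
theorem assemblyCore_post : ∃ g : List Bool → List Bool, g ∈ FP ∧ ∀ u y : List Bool, ∃ bit : Bool,
    g (boolPair u y) = [bit] ∧ (bit = true ↔ ∃ (x : List Bool) (qs ps : List ℕ) (i : ℕ),
      u = boolPair (boolPair x (boolPair (encodingListNatBool.encode qs) (encodingListNatBool.encode ps)))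
        (encodeNat i) ∧
      (∀ q ∈ qs, q.Prime) ∧ qs.prod = decodeNat x ∧ (¬ ∃ r : ℕ, r ^ 3 = decodeNat x) ∧
      (∀ p ∈ ps, p.Prime ∧ ¬ p ∣ 3 * decodeNat x) ∧ (decodeNat (boolUnpair y).1).testBit i = true) := by
  -- the three conjuncts on `p = (u, y)`
  have cU : CodeFP (pairE strE strE) strE Prod.fst := fst _ _
  have cCanon := (assemblyCore_codeFP_canon (P := fun u => @decide (∃ (x : List Bool) (qs ps : List ℕ) (i : ℕ),
      u = boolPair (boolPair x (boolPair (encodingListNatBool.encode qs) (encodingListNatBool.encode ps)))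
        (encodeNat i)) (Classical.dec _)) fun u => @decide_eq_true_iff _ (Classical.dec _)).comp cU
  have cProm := (assemblyCore_codeFP_promise (P := fun t => @decide ((∀ q ∈ t.2.1, q.Prime) ∧
      t.2.1.prod = decodeNat t.1 ∧ (¬ ∃ r : ℕ, r ^ 3 = decodeNat t.1) ∧ (∀ p ∈ t.2.2, p.Prime ∧ ¬ p ∣ 3 * decodeNat t.1))
      (Classical.dec _)) fun t => @decide_eq_true_iff _ (Classical.dec _)).comp (assemblyCore_codeFP_flds.fst'.comp cU)
  have cDec : CodeFP strE natE decodeNat := ⟨canonF, canonF_mem_FP, fun w => canonF_eq_encodeNat_decodeNat w⟩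
  have cY0 : CodeFP (pairE strE strE) strE (fun p => (boolUnpair p.2).1) :=
    ⟨fstF ∘ sndF, comp_mem_FP fstF_mem_FP sndF_mem_FP, fun p => by
      show fstF (sndF (boolPair p.1 p.2)) = _
      rw [Literature.Computability.Complexity.Brick.sndF_boolPair]; rfl⟩
  have cY1 : CodeFP (pairE strE strE) natE (fun p => decodeNat (boolUnpair p.2).1) := cDec.comp cY0
  have cBit : CodeFP (pairE strE strE) bitE
      (fun p => (decodeNat (boolUnpair p.2).1).testBit (decodeNat (boolUnpair p.1).2)) :=
    Literature.Computability.Cryptography.VDSOracle.codeFP_testBit.comp (cY1.pair (assemblyCore_codeFP_flds.snd'.comp cU))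
  obtain ⟨g, hg, hgs⟩ := (cCanon.and cProm).and cBit
  refine ⟨g, hg, fun u y => ⟨_, hgs (u, y), ?_⟩⟩
  simp only [Bool.and_eq_true, decide_eq_true_eq]
  constructor
  · rintro ⟨⟨⟨x, qs, ps, i, hu⟩, hP⟩, hbit⟩
    subst hu
    obtain ⟨h1, h2, h3, h4⟩ := assemblyCore_fields x qs ps i
    rw [h1, h2, h3] at hP
    rw [h4] at hbit
    exact ⟨x, qs, ps, i, rfl, hP.1, hP.2.1, hP.2.2.1, hP.2.2.2, hbit⟩
  · rintro ⟨x, qs, ps, i, rfl, hprime, hprod, hnc, hps, hbit⟩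
    obtain ⟨h1, h2, h3, h4⟩ := assemblyCore_fields x qs ps i
    refine ⟨⟨⟨x, qs, ps, i, rfl⟩, ?_⟩, ?_⟩
    · rw [h1, h2, h3]; exact ⟨hprime, hprod, hnc, hps⟩
    · rwa [h4]

/-! ## The registered stub -/

/-- **S6a `stub_assemblyCore`** (registered signature, skeleton v6): the two `FP` programs around the quantum core —
the pre-processor (h) and the post-processor (g). -/
theorem stub_assemblyCore :
    (∃ h : List Bool → List Bool, h ∈ FP ∧ ∀ (x : List Bool) (qs ps : List ℕ) (i : ℕ), ∃ f a b : ℕ,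
        h (boolPair (boolPair x (boolPair (encodingListNatBool.encode qs) (encodingListNatBool.encode ps)))
            (encodeNat i)) =
          boolPair x (boolPair (boolPair (encodeNat f) (boolPair (encodeNat a) (encodeNat b)))
            (encodingListNatBool.encode ps)) ∧
        ((∀ q ∈ qs, q.Prime) → qs.prod = f ^ 3 * (a * b ^ 2) ∧ Squarefree (a * b))) ∧
    (∃ g : List Bool → List Bool, g ∈ FP ∧ ∀ u y : List Bool, ∃ bit : Bool, g (boolPair u y) = [bit] ∧
        (bit = true ↔ ∃ (x : List Bool) (qs ps : List ℕ) (i : ℕ),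
          u = boolPair (boolPair x (boolPair (encodingListNatBool.encode qs) (encodingListNatBool.encode ps)))
            (encodeNat i) ∧
          (∀ q ∈ qs, q.Prime) ∧ qs.prod = decodeNat x ∧ (¬ ∃ r : ℕ, r ^ 3 = decodeNat x) ∧
          (∀ p ∈ ps, p.Prime ∧ ¬ p ∣ 3 * decodeNat x) ∧ (decodeNat (boolUnpair y).1).testBit i = true)) :=
  ⟨assemblyCore_pre, assemblyCore_post⟩

end Summit.QuantumAdvantage.QuantumAdvantage.Theorems.LinnikCubicClassGroups
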